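import Literature.NumberTheory.EllipticCurves.NeronLocalHeightBadPlacesProofs
import Literature.NumberTheory.EllipticCurves.NeronModelProofs
import Mathlib.NumberTheory.NumberField.Completion.FinitePlace
import Mathlib.NumberTheory.Ostrowski
import HarnessLib

/-!
# The Néron local height is non-negative at the places of potential good reduction

Topic `NumberTheory/EllipticCurves` (family `abc`, G06). Pure proofs, no definitions, no named
facts. This is the case `|j_E|_v ≤ 1` of the local height theory behind Petsche's Lemma 3
(`Literature.NumberTheory.EllipticCurves.Petsche2006_lemma3`, C. Petsche, New York J. Math. 12
(2006), §2, "Case 1: `|j_E|_v ≤ 1`. Then `j_v` is identically zero and `λ_v(P − Q) = i_v(P, Q)`"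
with `i_v ≥ 0`), in the form consumed by `Petsche2006_lemma3_of_localStructure`
(`LangHeightLemma3Counting.lean`) with `J = 0`, `r = 0`:

* `neronLocalHeight_padicAbv_nonneg_of_padicAbv_j_le_one` — for an elliptic curve `E/ℚ` (any
  Weierstrass equation `W`), a finite place `v` with `|j(E)|_v ≤ 1` and a rational point `P ≠ O`,
  `λ_v(P) ≥ 0` (`λ_v = neronLocalHeight (padicAbv v)`, Tate's series, ATAEC Thm. VI.1.1).

The printed justification (Silverman, *AEC*, Prop. VII.5.5: integral `j` ⟺ potential good
reduction; *ATAEC*, Thm. VI.1.1(b),(c) and Thm. VI.4.1) is formalised as follows. By the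
semistable reduction theorem (`WeierstrassCurve.exists_finite_isSemistable_holds`, AEC VII.5.4)
there is a number field `L` over which `E` has good or multiplicative reduction at every place; at
a place `w ∣ p_v` of `L` multiplicative reduction is excluded because it forces `|j|_w > 1`
(`j Δ = c₄³` on a minimal model, AEC VII.5.1(b)), so the local minimal model `X` of `E ⊗ L_w` has
good reduction, every point of `X(L_w)` has nonsingular reduction (`c_w = 1`,
`localTamagawaNumber_eq_one_of_hasGoodReduction_holds`) and ATAEC Thm. VI.4.1
(`le_neronLocalHeight_nsmul_of_index_dvd`) gives `λ_X ≥ (1/12) v(Δ_X) = 0` for the norm of the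
completion `L_w` (Mathlib's `NormedField` structure on `w.adicCompletion L`). Transporting `P`
along `E(ℚ) → E(L) → E(L_w) → X(L_w)` does not change Tate's series (ATAEC VI.1.1(c),
`neronLocalHeight_baseChange`; VI.1.1(b), `neronLocalHeight_pointMap`) computed with the
restriction `|·|'` of `‖·‖_w` to `ℚ`, a nonarchimedean absolute value with `|p_v|' < 1`, hence
`|·|' ^ c = |·|_v` for some `c > 0` by Ostrowski's theorem (Mathlib
`Rat.AbsoluteValue.equiv_padic_of_bounded`); finally Tate's series is homogeneous of degree one
under `|·| ↦ |·|^c` (`neronLocalHeight_eq_mul_of_rpow_eq`), so `λ_v(P) = c λ'(P) ≥ 0`.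

## References

* C. Petsche, *Small rational points on elliptic curves over number fields*, New York J. Math. 12
  (2006), 257–268 (arXiv math/0508160), §2 and Lemma 3.
* J. H. Silverman, *Advanced Topics in the Arithmetic of Elliptic Curves*, GTM 151 (1994),
  Thm. VI.1.1 (PDF pp. 419–422), Thm. VI.4.1 (PDF p. 428).
* J. H. Silverman, *The Arithmetic of Elliptic Curves*, 2nd ed. (2009), Prop. VII.5.1,
  Prop. VII.5.4, Prop. VII.5.5.
-/

noncomputable section

open scoped Classical NumberField

/-! ### Tate's series under a power of the absolute value -/

namespace WeierstrassCurve.Affine.Point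

section Rpow

variable {K : Type*} [Field K] {v₁ v₂ : AbsoluteValue K ℝ} {c : ℝ} (hc : 0 < c)
  (h : ∀ x : K, v₁ x ^ c = v₂ x) {W : WeierstrassCurve K}
include hc h

omit h in
/-- `log (a ^ c) = c log a` for `a ≥ 0` (also at `a = 0`, where both sides vanish). [folklore] -/
theorem log_rpow_of_nonneg' {a : ℝ} (ha : 0 ≤ a) : Real.log (a ^ c) = c * Real.log a := by
  rcases ha.eq_or_lt with rfl | ha
  · rw [Real.zero_rpow hc.ne', Real.log_zero, mul_zero]
  · exact Real.log_rpow ha c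

omit h in
/-- `max (a ^ c) (b ^ c) = (max a b) ^ c` for `a, b ≥ 0`, `c > 0`. [folklore] -/
theorem max_rpow_eq {a b : ℝ} (ha : 0 ≤ a) (hb : 0 ≤ b) : max (a ^ c) (b ^ c) = (max a b) ^ c := by
  rcases le_total a b with hab | hab
  · rw [max_eq_right hab, max_eq_right (Real.rpow_le_rpow ha hab hc.le)]
  · rw [max_eq_left hab, max_eq_left (Real.rpow_le_rpow hb hab hc.le)]

/-- The naive height scales: `λ₁[v^c] = c · λ₁[v]`. [folklore] -/
theorem naiveLocalHeight_eq_mul_of_rpow_eq (P : W.toAffine.Point) :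
    naiveLocalHeight v₂ P = c * naiveLocalHeight v₁ P := by
  rcases P with _ | ⟨x, y, hP⟩
  · simp [naiveLocalHeight]
  · rw [naiveLocalHeight_some, naiveLocalHeight_some, ← h x, Real.posLog, Real.posLog,
      log_rpow_of_nonneg' hc (v₁.nonneg x)]
    have : max 0 (c * Real.log (v₁ x)) = c * max 0 (Real.log (v₁ x)) := by
      rw [← mul_zero c, ← mul_max_of_nonneg _ _ hc.le, mul_zero]
    rw [this]
    ring

/-- Tate's correction term scales: `f[v^c] = c · f[v]`. [folklore] -/
theorem tateCorrection_eq_mul_of_rpow_eq (P : W.toAffine.Point) :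
    tateCorrection v₂ P = c * tateCorrection v₁ P := by
  rcases P with _ | ⟨x, y, hP⟩
  · rw [← WeierstrassCurve.Affine.Point.zero_def, tateCorrection_zero, tateCorrection_zero, ← h,
      log_rpow_of_nonneg' hc (v₁.nonneg _)]
    ring
  · rw [tateCorrection_some, tateCorrection_some, ← h, ← h, ← h, ← h,
      log_rpow_of_nonneg' hc (v₁.nonneg _), max_rpow_eq hc (v₁.nonneg _) (v₁.nonneg _)]
    have h4 : (v₁ x ^ c) ^ 4 = (v₁ x ^ 4) ^ c := by
      rw [← Real.rpow_natCast, ← Real.rpow_natCast, ← Real.rpow_mul (v₁.nonneg x),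
        ← Real.rpow_mul (v₁.nonneg x), mul_comm]
    have h1 : (1 : ℝ) = 1 ^ c := (Real.one_rpow c).symm
    rw [h4, h1, max_rpow_eq hc (pow_nonneg (v₁.nonneg x) 4) zero_le_one, ← h1,
      ← Real.div_rpow (le_max_of_le_left (v₁.nonneg _)) (le_max_of_le_right zero_le_one),
      log_rpow_of_nonneg' hc (div_nonneg (le_max_of_le_left (v₁.nonneg _))
        (le_max_of_le_right zero_le_one))]
    ring

/-- Tate's series scales: `μ[v^c] = c · μ[v]`. [folklore] -/
theorem tateMu_eq_mul_of_rpow_eq (P : W.toAffine.Point) : tateMu v₂ P = c * tateMu v₁ P := by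
  unfold tateMu
  rw [← tsum_mul_left]
  refine tsum_congr fun n => ?_
  rw [tateCorrection_eq_mul_of_rpow_eq hc h]
  ring

/-- **Tate's `λ` is homogeneous of degree one in the absolute value**: if `|x|₂ = |x|₁ ^ c` for all
`x` (`c > 0`), then `λ[|·|₂](P) = c · λ[|·|₁](P)` for every point (all terms of Tate's series are
logarithms of absolute values; ATAEC Thm. VI.1.1, normalisation of `v`). [folklore] -/
theorem neronLocalHeight_eq_mul_of_rpow_eq (P : W.toAffine.Point) :
    neronLocalHeight v₂ P = c * neronLocalHeight v₁ P := by
  rw [neronLocalHeight, neronLocalHeight, naiveLocalHeight_eq_mul_of_rpow_eq hc h,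
    tateMu_eq_mul_of_rpow_eq hc h]
  ring

end Rpow

end WeierstrassCurve.Affine.Point

namespace Literature.NumberTheory.EllipticCurves

open IsDedekindDomain Rat.HeightOneSpectrum

/-! ### Ostrowski: a nonarchimedean absolute value of `ℚ` small at `p` is a power of `|·|_p` -/

/-- **Ostrowski's theorem, normalised form**: a nonarchimedean absolute value `f` on `ℚ` with
`f(p_v) < 1` satisfies `f ^ c = |·|_v` (`Rat.HeightOneSpectrum.padicAbv v`, `|p_v|_v = p_v⁻¹`) for
some `c > 0` (Mathlib `Rat.AbsoluteValue.equiv_padic_of_bounded`: `f` is equivalent to `|·|_q` for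
a unique prime `q`, and `q = p_v` since `|p_v|_q = f(p_v)^c < 1`). [folklore] -/
theorem exists_rpow_eq_padicAbv (v : HeightOneSpectrum ℤ) {f : AbsoluteValue ℚ ℝ}
    (hna : IsNonarchimedean f) (hp : f (natGenerator v) < 1) :
    ∃ c : ℝ, 0 < c ∧ ∀ x : ℚ, f x ^ c = padicAbv v x := by
  have hprime := prime_natGenerator v
  have hnt : f.IsNontrivial :=
    ⟨natGenerator v, by exact_mod_cast hprime.ne_zero, hp.ne⟩
  obtain ⟨q, ⟨hq, hequiv⟩, -⟩ :=
    Rat.AbsoluteValue.equiv_padic_of_bounded hnt fun n => hna.apply_natCast_le_one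
  obtain ⟨c, hc, hceq⟩ := AbsoluteValue.isEquiv_iff_exists_rpow_eq.mp hequiv
  have hcq : ∀ x : ℚ, f x ^ c = Rat.AbsoluteValue.padic q x := fun x => congrFun hceq x
  -- `q = p_v`
  have hlt : Rat.AbsoluteValue.padic q (natGenerator v) < 1 := by
    rw [← hcq]
    exact Real.rpow_lt_one (f.nonneg _) hp hc
  have hdvd : q ∣ natGenerator v := by
    have : (padicNorm q (natGenerator v : ℚ) : ℝ) < 1 := hlt
    exact (padicNorm.nat_lt_one_iff _).mp (by exact_mod_cast this)
  have hqp : q = natGenerator v := (Nat.prime_dvd_prime_iff_eq hq.out hprime).mp hdvd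
  subst hqp
  exact ⟨c, hc, hcq⟩

/-! ### A place above `p` of a number field, its completion, and the reduction type there -/

section NumberField

variable {L : Type*} [Field L] [NumberField L]

/-- Over every rational prime `p` there is a finite place of the number field `L`
(a maximal ideal of `𝓞 L` above `pℤ`, by going-up for the integral extension `ℤ ⊂ 𝓞 L`).
(A private copy of `exists_heightOneSpectrum_natCast_mem` of
`ComplexMultiplicationBurungaleFlachPrimaryProofs.lean`, to avoid its imports.) [folklore] -/
private theorem exists_place_natCast_mem {p : ℕ} (hp : p.Prime) :
    ∃ w : HeightOneSpectrum (𝓞 L), (p : 𝓞 L) ∈ w.asIdeal := by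
  have hpZ : Prime (p : ℤ) := Nat.prime_iff_prime_int.mp hp
  haveI hpI : (Ideal.span {(p : ℤ)}).IsMaximal :=
    ((Ideal.span_singleton_prime hpZ.ne_zero).mpr hpZ).isMaximal (by simpa using hpZ.ne_zero)
  obtain ⟨Q, hQmax, hQover⟩ :=
    Ideal.exists_maximal_ideal_liesOver_of_isIntegral (S := 𝓞 L) (Ideal.span {(p : ℤ)})
  have hQne : Q ≠ ⊥ := by
    rintro rfl
    have h1 : Ideal.span {(p : ℤ)} = Ideal.comap (algebraMap ℤ (𝓞 L)) ⊥ := hQover.over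
    rw [Ideal.comap_bot_of_injective (algebraMap ℤ (𝓞 L)) (RingHom.injective_int _)] at h1
    exact hpZ.ne_zero (Ideal.span_singleton_eq_bot.mp h1)
  refine ⟨⟨Q, hQmax.isPrime, hQne⟩, ?_⟩
  have h1 : (p : ℤ) ∈ Q.under ℤ := hQover.over ▸ Ideal.mem_span_singleton_self _
  simpa using h1

variable (w : HeightOneSpectrum (𝓞 L))

/-- The valuation of `L_w` attached to the maximal ideal of `O_w` is equivalent to `Valued.v`
(both have valuation ring `O_w`). [folklore] -/
theorem isEquiv_valuation_maximalIdeal_valued :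
    ((IsDiscreteValuationRing.maximalIdeal (w.adicCompletionIntegers L)).valuation
      (w.adicCompletion L)).IsEquiv (Valued.v : Valuation (w.adicCompletion L) (WithZero (Multiplicative ℤ))) :=
  WeierstrassCurve.isEquiv_valuation_maximalIdeal_of_le_one_iff
    (WeierstrassCurve.valued_le_one_iff_mem_range_adicCompletionIntegers w)

/-- **Multiplicative reduction forces `|j|_w > 1`** (Silverman, AEC Prop. VII.5.1(b): for a minimal
equation multiplicative reduction means `v(Δ) > 0`, `v(c₄) = 0`, so `v(j) = 3v(c₄) − v(Δ) < 0`):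
if the elliptic curve `E/L` has multiplicative reduction at `w` then `‖j(E)‖ > 1` in `L_w`,
because `j · Δ_X = c₄(X)³` on the local minimal model `X`. [cite: SilvermanAEC2009, Prop. VII.5.1(b)] -/
theorem one_lt_norm_j_of_hasMultiplicativeReductionAt (E : WeierstrassCurve L) [E.IsElliptic]
    (hmult : E.HasMultiplicativeReductionAt w) :
    1 < ‖algebraMap L (w.adicCompletion L) E.j‖ := by
  rw [← not_le]
  intro hjle
  haveI : (E.localMinimalModel w).IsElliptic := E.isElliptic_localMinimalModel w
  have hm : (E.localMinimalModel w).HasMultiplicativeReduction (w.adicCompletionIntegers L) :=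
    hmult
  set C : WeierstrassCurve.VariableChange (w.adicCompletion L) :=
    ((E.baseChange (w.adicCompletion L)).exists_isMinimal (w.adicCompletionIntegers L)).choose
  have hX : E.localMinimalModel w = C • E.baseChange (w.adicCompletion L) := rfl
  -- `j · Δ_X = c₄(X)³`
  have hj' : (C • E.baseChange (w.adicCompletion L)).j = algebraMap L (w.adicCompletion L) E.j := by
    rw [WeierstrassCurve.variableChange_j]
    exact E.map_j _
  have key : algebraMap L (w.adicCompletion L) E.j * (E.localMinimalModel w).Δ =
      (E.localMinimalModel w).c₄ ^ 3 := by
    change algebraMap L (w.adicCompletion L) E.j * (C • E.baseChange (w.adicCompletion L)).Δ =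
      (C • E.baseChange (w.adicCompletion L)).c₄ ^ 3
    rw [← hj', WeierstrassCurve.j, ← WeierstrassCurve.coe_Δ', mul_comm, ← mul_assoc,
      Units.mul_inv, one_mul]
  -- valuations
  have hE := isEquiv_valuation_maximalIdeal_valued w
  have hjle' : (Valued.v : Valuation (w.adicCompletion L) (WithZero (Multiplicative ℤ)))
      (algebraMap L (w.adicCompletion L) E.j) ≤ 1 :=
    Valued.toNormedField.norm_le_one_iff.mp hjle
  have hjle'' := (Valuation.isEquiv_iff_val_le_one.mp hE).mpr hjle'
  have hlt := hm.badReduction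
  have hc₄ := hm.multiplicativeReduction
  have h1 : (IsDiscreteValuationRing.maximalIdeal (w.adicCompletionIntegers L)).valuation
      (w.adicCompletion L) ((E.localMinimalModel w).c₄ ^ 3) < 1 := by
    rw [← key, map_mul]
    calc _ ≤ (IsDiscreteValuationRing.maximalIdeal (w.adicCompletionIntegers L)).valuation
          (w.adicCompletion L) (E.localMinimalModel w).Δ := mul_le_of_le_one_left' hjle''
      _ < 1 := hlt
  rw [map_pow, hc₄, one_pow] at h1
  exact lt_irrefl _ h1

/-- At a place of good reduction every point of `X(L_w)`, `X` the local minimal model, lies in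
`X₀(L_w)`: the index `[X(L_w) : X₀(L_w)]` is `1` (`localTamagawaNumber_eq_one_of_hasGoodReduction_holds`,
Silverman AEC VII.2, remark after Prop. 2.1). [folklore] -/
theorem index_goodReductionSubgroup_localMinimalModel_eq_one (E : WeierstrassCurve L)
    (hgood : E.HasGoodReductionAt w) :
    ((E.localMinimalModel w).goodReductionSubgroup (w.adicCompletionIntegers L)).index = 1 := by
  haveI : ((E.baseChange (w.adicCompletion L)).minimal (w.adicCompletionIntegers L)).HasGoodReduction
      (w.adicCompletionIntegers L) := hgood
  exact WeierstrassCurve.localTamagawaNumber_eq_one_of_hasGoodReduction_holds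
    (w.adicCompletionIntegers L) (E.baseChange (w.adicCompletion L))

/-- At a place of good reduction the discriminant of the local minimal model is a `w`-adic unit:
`‖Δ_X‖ = 1`. [folklore] -/
theorem norm_Δ_localMinimalModel_eq_one (E : WeierstrassCurve L) (hgood : E.HasGoodReductionAt w) :
    ‖(E.localMinimalModel w).Δ‖ = 1 := by
  have hΔ : (IsDiscreteValuationRing.maximalIdeal (w.adicCompletionIntegers L)).valuation
      (w.adicCompletion L) (E.localMinimalModel w).Δ = 1 :=
    (hgood : (E.localMinimalModel w).HasGoodReduction (w.adicCompletionIntegers L)).goodReduction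
  have hE := isEquiv_valuation_maximalIdeal_valued w
  have hv1 : (Valued.v : Valuation (w.adicCompletion L) (WithZero (Multiplicative ℤ)))
      (E.localMinimalModel w).Δ = 1 :=
    (Valuation.isEquiv_iff_val_eq_one.mp hE).mp hΔ
  refine le_antisymm (Valued.toNormedField.norm_le_one_iff.mpr hv1.le) ?_
  by_contra hlt
  push Not at hlt
  exact (Valued.toNormedField.norm_lt_one_iff.mp hlt).ne hv1

end NumberField

/-! ### The theorem -/

open _root_.WeierstrassCurve _root_.WeierstrassCurve.Affine.Point

/-- **`λ_v ≥ 0` at the places of potential good reduction** (Petsche 2006, §2, Case 1: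
`|j_E|_v ≤ 1 ⟹ λ_v = i_v ≥ 0`; Silverman AEC Prop. VII.5.5 with ATAEC Thm. VI.1.1(b),(c) and
Thm. VI.4.1). For an elliptic curve over `ℚ` given by any Weierstrass equation `W`, a finite place
`v` with `|j(W)|_v ≤ 1`, and a rational point `P ≠ O`: `0 ≤ λ_v(P)`, where
`λ_v = neronLocalHeight (padicAbv v)` is Tate's series. Proof: see the module docstring
(semistable reduction over a number field `L`, good reduction at a place `w ∣ p_v`, VI.4.1 on the
local minimal model over `L_w`, transport of Tate's series, Ostrowski).
[cite: Petsche2006, §2 (Case 1) and Lemma 3] [cite: Silverman1994, Thm VI.4.1] -/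
theorem neronLocalHeight_padicAbv_nonneg_of_padicAbv_j_le_one (W : WeierstrassCurve ℚ) [W.IsElliptic]
    (v : HeightOneSpectrum ℤ) (hj : padicAbv v W.j ≤ 1) (P : W.toAffine.Point) (hP : P ≠ 0) :
    0 ≤ P.neronLocalHeight (padicAbv v) := by
  -- Step 1: a number field `L` over which `W` is semistable
  obtain ⟨L, _instF, _instA, _instFD, _instSep, _instAZ, _instST, hsemi⟩ :=
    W.exists_finite_isSemistable_holds (A := ℤ)
  haveI : CharZero L := charZero_of_injective_algebraMap (algebraMap ℚ L).injective
  obtain rfl : _instA = DivisionRing.toRatAlgebra := Subsingleton.elim _ _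
  obtain rfl : _instAZ = Ring.toIntAlgebra L := Subsingleton.elim _ _
  haveI : NumberField L := @NumberField.mk L _ _ _instFD
  haveI : IsScalarTower ℤ (𝓞 L) L := IsScalarTower.of_algebraMap_eq fun z => by simp
  have hss : (W.baseChange L).IsSemistable (𝓞 L) := hsemi (𝓞 L)
  -- Step 2: a place `w` of `L` above `p = p_v`, the completion `L_w ⊃ O_w` and its norm
  set p : ℕ := natGenerator v with hp
  have hprime : p.Prime := prime_natGenerator v
  obtain ⟨w, hpw⟩ := exists_place_natCast_mem (L := L) hprime
  let Kw := w.adicCompletion L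
  let Ow := w.adicCompletionIntegers L
  let abw : AbsoluteValue Kw ℝ := NormedField.toAbsoluteValue Kw
  have hna : IsNonarchimedean abw := fun x y => IsUltrametricDist.norm_add_le_max x y
  have hle : ∀ x : Kw, abw x ≤ 1 ↔ Valued.v x ≤ 1 := fun x => Valued.toNormedField.norm_le_one_iff
  have hint : (Valued.v : Valuation Kw (WithZero (Multiplicative ℤ))).Integers Ow :=
    Valuation.integer.integers _
  -- the absolute values down the tower `ℚ ⊂ L ⊂ L_w`
  let vL : AbsoluteValue L ℝ := abw.comp (algebraMap L Kw).injective
  let vQ : AbsoluteValue ℚ ℝ := vL.comp (algebraMap ℚ L).injective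
  have hvQ_apply : ∀ x : ℚ, vQ x = ‖algebraMap L Kw (algebraMap ℚ L x)‖ := fun x => rfl
  have hvQna : IsNonarchimedean vQ := by
    intro x y
    rw [hvQ_apply, hvQ_apply, hvQ_apply, map_add, map_add]
    exact hna _ _
  -- `vQ p < 1` since `p ∈ w`
  have hvQp : vQ p < 1 := by
    rw [hvQ_apply, map_natCast (algebraMap ℚ L), Valued.toNormedField.norm_lt_one_iff,
      WeierstrassCurve.valued_algebraMap_adicCompletion]
    have e1 : (p : L) = algebraMap (𝓞 L) L (p : 𝓞 L) := by simp
    rw [e1]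
    exact (HeightOneSpectrum.valuation_lt_one_iff_mem _ _).mpr hpw
  -- Ostrowski: `vQ ^ c = |·|_v`
  obtain ⟨c, hc, hcv⟩ := exists_rpow_eq_padicAbv v hvQna hvQp
  -- Step 3: good reduction at `w` (multiplicative is excluded by `|j|_w ≤ 1`)
  haveI : (W.baseChange L).IsElliptic := inferInstanceAs (W.map _).IsElliptic
  have hjw : ‖algebraMap L Kw (W.baseChange L).j‖ ≤ 1 := by
    have h1 : (W.baseChange L).j = algebraMap ℚ L W.j := W.map_j _
    rw [h1, ← hvQ_apply]
    have h2 : vQ W.j ^ c ≤ 1 ^ c := by rw [hcv, Real.one_rpow]; exact hj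
    exact (Real.rpow_le_rpow_iff (vQ.nonneg _) zero_le_one hc).mp h2
  have hgood : (W.baseChange L).HasGoodReductionAt w := by
    rcases hss w with hg | hm
    · exact hg
    · exact absurd hjw (not_le.mpr (one_lt_norm_j_of_hasMultiplicativeReductionAt w _ hm))
  -- Step 4: transport `P` to the local minimal model `X = C • (W ⊗ L_w)` over `L_w`
  let EL : WeierstrassCurve L := W.baseChange L
  let ιa : W.toAffine.Point →+ EL.toAffine.Point := Affine.Point.baseChange (W' := W) ℚ L
  let ιb : EL.toAffine.Point →+ (EL.baseChange Kw).toAffine.Point :=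
    Affine.Point.baseChange (W' := EL) L Kw
  have hιa : ∀ {x y : ℚ} (h : W.toAffine.Nonsingular x y),
      ∃ h', ιa (.some x y h) = .some (algebraMap ℚ L x) (algebraMap ℚ L y) h' :=
    fun _ => ⟨_, rfl⟩
  have hιb : ∀ {x y : L} (h : EL.toAffine.Nonsingular x y),
      ∃ h', ιb (.some x y h) = .some (algebraMap L Kw x) (algebraMap L Kw y) h' :=
    fun _ => ⟨_, rfl⟩
  let C : VariableChange Kw := ((EL.baseChange Kw).exists_isMinimal Ow).choose
  have hX : EL.localMinimalModel w = C • EL.baseChange Kw := rfl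
  haveI : (EL.baseChange Kw).IsElliptic := inferInstanceAs ((W.baseChange L).map _).IsElliptic
  have hne : ιb (ιa P) ≠ 0 := fun h0 =>
    hP (Affine.Point.map_injective (Algebra.ofId ℚ L)
      ((Affine.Point.map_injective (Algebra.ofId L Kw) (h0.trans (map_zero ιb).symm)).trans
        (map_zero ιa).symm))
  have h2 : (2 : Kw) ≠ 0 := by
    rw [← map_ofNat (algebraMap L Kw) 2]
    exact (map_ne_zero_iff _ (algebraMap L Kw).injective).mpr two_ne_zero
  -- `λ_X(C · P) = λ[vQ](P)` (ATAEC VI.1.1(b),(c))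
  have hlam : neronLocalHeight abw (VariableChange.pointMap (EL.baseChange Kw) C (ιb (ιa P))) =
      P.neronLocalHeight vQ := by
    rw [neronLocalHeight_pointMap abw C h2 hne,
      neronLocalHeight_baseChange (vF := vL) (vK := abw) ιb hιb (fun _ => rfl),
      neronLocalHeight_baseChange (vF := vQ) (vK := vL) ιa hιa (fun _ => rfl)]
  -- Step 5: ATAEC VI.4.1 on `X₀(L_w) = X(L_w)`: `λ_X ≥ (1/12) v(Δ_X) = 0`
  have hidx : ((EL.localMinimalModel w).goodReductionSubgroup Ow).index ∣ 1 := by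
    rw [index_goodReductionSubgroup_localMinimalModel_eq_one w EL hgood]
  have hloc := le_neronLocalHeight_nsmul_of_index_dvd hint hna hle (EL.localMinimalModel w) hidx
    (VariableChange.pointMap (EL.baseChange Kw) C (ιb (ιa P)))
  have hΔ : abw (EL.localMinimalModel w).Δ = 1 := norm_Δ_localMinimalModel_eq_one w EL hgood
  have h0 : -(1 / 12 * Real.log (abw (EL.localMinimalModel w).Δ)) = 0 := by
    rw [hΔ, Real.log_one, mul_zero, _root_.neg_zero]
  have hnn : 0 ≤ neronLocalHeight abw
      ((1 : ℕ) • VariableChange.pointMap (EL.baseChange Kw) C (ιb (ιa P))) :=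
    h0.symm.trans_le hloc
  rw [one_nsmul, hlam] at hnn
  -- Step 6: back to `|·|_v = vQ ^ c`
  rw [neronLocalHeight_eq_mul_of_rpow_eq hc hcv P]
  exact mul_nonneg hc.le hnn

end Literature.NumberTheory.EllipticCurves

end
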